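import Summits.CriticalPhenomena.CardyFormulaZ2.Theorems.CardyAnchoredRigidityClusterSetConnectedStubSandwichLowerChains
import Summits.CriticalPhenomena.CardyFormulaZ2.Theorems.CardyAnchoredRigidityClusterSetConnectedStubSandwichLowerGeometry
import Literature.Probability.Percolation.BoxCrossingJordan
import Literature.Probability.Percolation.DiscreteDomainPaths
import HarnessLib

/-!
# Crux `ClusterSetConnected`, line `registered` — stub `stub_sandwichLowerOfWalks` (S1a)

The lower half of the deterministic sandwich between G02's discrete crossing event
`discreteCrossing Ω δ (arc 0) (arc 2)` (an open path of the largest mesh component `Ω_δ` between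
the discretised arcs, `Crossings.lean` / `DomainDiscretisation.lean`) and the Schramm–Smirnov
continuum crossing events `quadCrossing` of the perturbations `perturbQuad Φ x₀ x₁ y₀ y₁` of a square
model `Φ` of the conformal rectangle `R` (`QuadCrossingSquareModel.lean`): for `0 < s < 1` and all
small meshes, `quadCrossing (Φ([-1+s,1-s] × [-1-s,1+s])) δ ⊆ discreteCrossing R.carrier δ (R.arc 0) (R.arc 2)`,
GIVEN the walk-extraction lemma `stub_walkExtraction` (taken as the hypothesis, verbatim; landed
separately). Chain bookkeeping: `…StubSandwichLowerChains.lean`; square-model geometry and the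
discrete-arc anchoring: `…StubSandwichLowerGeometry.lean`. Works for EVERY Jordan conformal
rectangle (no hypothesis on the boundary): edges of the shadowing open chain that leave `Ω̄` are
classified by the side (bottom / top) through which they leave, the bulk property of the
discretisation (`forall_mem_meshDomain_of_isCompact`, every Jordan domain) puts the crossing run in
the largest component.
-/

noncomputable section

open Set Metric
open Literature.Probability.Percolation Literature.Probability.LatticeModels
open Literature.Probability.RandomPlanarGeometry

namespace Summit.CriticalPhenomena.CardyFormulaZ2.Theorems.ClusterSetConnected

/-- **stub_sandwichLowerOfWalks** (S1a). Given the walk-extraction lemma (S1a-W, the hypothesis,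
stated verbatim), for a square model `Φ` of `R` and `0 < s < 1`, at every small enough mesh the
continuum crossing event of the tall-narrow perturbation `T_s = Φ([-1+s,1-s] × [-1-s,1+s])` is
contained in G02's discrete crossing event of `R` between the discretised arcs `0` and `2`.

Proof. A continuum crossing of `T_s` inside the drawn open edges is shadowed by an open lattice
chain `f 0 ∼ ⋯ ∼ f (n+1)` whose sites are within `δ` of it; in the model coordinates `Φ⁻¹` the
chain stays in the band `|re| ≤ 1 - s/2`, starts below height `-1` and ends above height `1`, and
consecutive sites / points of one drawn edge are `τ`-close (`τ ≤ s/2`, `τ ≤ 1/2`; uniform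
continuity of `Φ⁻¹`). Every edge is GOOD (an edge of the mesh graph between vertices of `Ω`) or
LOW (reaches height `≤ -1`) or HIGH (reaches height `≥ 1`); between the last low non-good edge
`k₁` before the first high non-good edge `k₂` all edges are good (`exists_good_run`). The run
`f (k₁+1), …, f k₂` passes height `-1/2 ≤ · ≤ 1/2` (`exists_first_ge`), hence meets a fixed compact
`K ⊆ Ω` all of whose lattice points lie in the largest mesh component for small `δ` (bulk property
`forall_mem_meshDomain_of_isCompact`), so the whole run lies in `Ω_δ` (`forall_of_chain`); its ends
are discrete boundary vertices anchored at arc `0`, resp. arc `2` (`mem_discreteArc_zero/two`),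
and it is an open path of `Ω_δ` (`reachable_of_chain`). -/
theorem stub_sandwichLowerOfWalks :
    (∀ (δ : ℝ), 0 < δ → ∀ (ω : Literature.Probability.Percolation.BondConfig (Literature.Probability.LatticeModels.Site 2))
      (K : Set ℂ), IsCompact K → IsConnected K →
      K ⊆ Literature.Probability.Percolation.openEdgeUnion δ ω → ∀ a ∈ K, ∀ b ∈ K,
        ∃ (n : ℕ) (f : ℕ → Literature.Probability.LatticeModels.Site 2),
          a ∈ segment ℝ (Literature.Probability.LatticeModels.meshPoint δ (f 0))
              (Literature.Probability.LatticeModels.meshPoint δ (f 1)) ∧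
          b ∈ segment ℝ (Literature.Probability.LatticeModels.meshPoint δ (f n))
              (Literature.Probability.LatticeModels.meshPoint δ (f (n + 1))) ∧
          (∀ j ≤ n, (Literature.Probability.LatticeModels.zdGraph 2).Adj (f j) (f (j + 1)) ∧
            s(f j, f (j + 1)) ∈ ω) ∧
          ∀ j ≤ n + 1, Metric.infDist (Literature.Probability.LatticeModels.meshPoint δ (f j)) K ≤ δ) →
    ∀ (R : Literature.Probability.RandomPlanarGeometry.ConformalRectangle) (Φ : ℂ ≃ₜ ℂ),
      Literature.Probability.Percolation.IsSquareModel R Φ →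
      ∀ (s : ℝ) (hx : (-1 + s : ℝ) < 1 - s) (hy : (-1 - s : ℝ) < 1 + s), 0 < s →
        ∃ δ₀ > (0 : ℝ), ∀ δ : ℝ, 0 < δ → δ < δ₀ →
          Literature.Probability.Percolation.quadCrossing
              (Literature.Probability.Percolation.perturbQuad Φ (-1 + s) (1 - s) (-1 - s) (1 + s) hx hy) δ ⊆
            Literature.Probability.Percolation.discreteCrossing R.carrier δ (R.arc 0) (R.arc 2) := by
  intro hW R Φ hΦ s hx hy hs
  -- real and imaginary parts are `1`-Lipschitz
  have abs_re_sub_re_le_dist : ∀ u v : ℂ, |u.re - v.re| ≤ dist u v := fun u v => by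
    rw [← Complex.sub_re, dist_eq_norm]; exact Complex.abs_re_le_norm _
  have abs_im_sub_im_le_dist : ∀ u v : ℂ, |u.im - v.im| ≤ dist u v := fun u v => by
    rw [← Complex.sub_im, dist_eq_norm]; exact Complex.abs_im_le_norm _
  -- the closeness scale `τ ≤ s/2`, `τ ≤ 1/2` in the model
  obtain ⟨τ, hτs, hτh, hτ0⟩ : ∃ τ : ℝ, τ ≤ s / 2 ∧ τ ≤ 1 / 2 ∧ 0 < τ :=
    ⟨min (s / 2) (1 / 2), min_le_left _ _, min_le_right _ _, by positivity⟩
  -- uniform modulus of `Φ⁻¹` on a compact neighbourhood of the closed tall quad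
  have hNc : IsCompact (cthickening 1 (Φ '' (Icc (-1 + s) (1 - s) ×ℂ Icc (-1 - s) (1 + s)))) :=
    ((isCompact_Icc.reProdIm isCompact_Icc).image Φ.continuous).cthickening
  obtain ⟨η, hη, hmod⟩ : ∃ η > (0 : ℝ), ∀ z ∈ cthickening 1 (Φ '' (Icc (-1 + s) (1 - s) ×ℂ Icc (-1 - s) (1 + s))),
      ∀ z' ∈ cthickening 1 (Φ '' (Icc (-1 + s) (1 - s) ×ℂ Icc (-1 - s) (1 + s))),
        dist z z' < η → dist (Φ.symm z) (Φ.symm z') < τ := by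
    obtain ⟨η, hη, h⟩ := Metric.uniformContinuousOn_iff.1
      (hNc.uniformContinuousOn_of_continuous Φ.symm.continuous.continuousOn) τ hτ0
    exact ⟨η, hη, h⟩
  -- the bulk compact `Φ([-1+s/2, 1-s/2] × [-1/2, 1/2]) ⊆ Ω`
  have hKc : IsCompact (Φ '' (Icc (-1 + s / 2) (1 - s / 2) ×ℂ Icc (-1 / 2 : ℝ) (1 / 2))) :=
    (isCompact_Icc.reProdIm isCompact_Icc).image Φ.continuous
  have hKΩ : Φ '' (Icc (-1 + s / 2) (1 - s / 2) ×ℂ Icc (-1 / 2 : ℝ) (1 / 2)) ⊆ R.carrier := by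
    rintro _ ⟨p, hp, rfl⟩
    rw [SquareModelDict.mem_carrier_iff hΦ, Homeomorph.symm_apply_apply]
    rw [Complex.mem_reProdIm, mem_Icc, mem_Icc] at hp
    exact ⟨⟨by linarith [hp.1.1], by linarith [hp.1.2]⟩, ⟨by linarith [hp.2.1], by linarith [hp.2.2]⟩⟩
  obtain ⟨δ₂, hδ₂, hbulk⟩ := forall_mem_meshDomain_of_isCompact R _ hKc hKΩ
  -- separation of the low/high bands from the far arcs
  obtain ⟨ρ₀, hρ₀, hsep₀⟩ := exists_sep_low hΦ hs
  obtain ⟨ρ₂, hρ₂, hsep₂⟩ := exists_sep_high hΦ hs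
  refine ⟨min (min η (1 / 2)) (min δ₂ (min ρ₀ ρ₂)), by positivity, ?_⟩
  intro δ hδ hδlt
  have hδη : δ < η := hδlt.trans_le ((min_le_left _ _).trans (min_le_left _ _))
  have hδhalf : δ < 1 / 2 := hδlt.trans_le ((min_le_left _ _).trans (min_le_right _ _))
  have hδ₂' : δ < δ₂ := hδlt.trans_le ((min_le_right _ _).trans (min_le_left _ _))
  have hδρ₀ : δ < ρ₀ := hδlt.trans_le ((min_le_right _ _).trans ((min_le_right _ _).trans (min_le_left _ _)))
  have hδρ₂ : δ < ρ₂ := hδlt.trans_le ((min_le_right _ _).trans ((min_le_right _ _).trans (min_le_right _ _)))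
  intro ω hω
  obtain ⟨a, ha, b, hb, γ, hγ⟩ := hω
  -- the crossing in the model
  have haim : (Φ.symm a).im = -1 - s := ((mem_perturbQuad_arc_zero hx hy Φ).1 ha).1
  have hbim : (Φ.symm b).im = 1 + s := ((mem_perturbQuad_arc_two hx hy Φ).1 hb).1
  have hKrect : ∀ k ∈ range γ, (Φ.symm k).re ∈ Icc (-1 + s) (1 - s) ∧ (Φ.symm k).im ∈ Icc (-1 - s) (1 + s) := by
    rintro _ ⟨t, rfl⟩
    exact (mem_closure_perturbQuad_carrier hx hy Φ).1 (hγ t).1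
  have hKimg : range γ ⊆ Φ '' (Icc (-1 + s) (1 - s) ×ℂ Icc (-1 - s) (1 + s)) := by
    rintro _ ⟨t, rfl⟩
    rw [← closure_perturbQuad_carrier hx hy Φ]
    exact (hγ t).1
  have hKO : range γ ⊆ openEdgeUnion δ ω := by
    rintro _ ⟨t, rfl⟩; exact (hγ t).2
  -- the shadowing open lattice chain
  obtain ⟨n, f, haf, hbf, hadjω, hnear⟩ := hW δ hδ ω (range γ) (isCompact_range γ.continuous)
    (isConnected_range γ.continuous) hKO a ⟨0, γ.source⟩ b ⟨1, γ.target⟩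
  -- a point of the crossing within `δ` of each site
  have hvert : ∀ j ≤ n + 1, ∃ k ∈ range γ, dist (meshPoint δ (f j)) k ≤ δ := by
    intro j hj
    obtain ⟨k, hk, hkd⟩ := (isCompact_range γ.continuous).exists_infDist_eq_dist (range_nonempty γ)
      (meshPoint δ (f j))
    exact ⟨k, hk, hkd ▸ hnear j hj⟩
  -- sites and drawn edges lie in the compact neighbourhood `N`
  have hvertN : ∀ j ≤ n + 1, meshPoint δ (f j) ∈
      cthickening 1 (Φ '' (Icc (-1 + s) (1 - s) ×ℂ Icc (-1 - s) (1 + s))) := by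
    intro j hj
    obtain ⟨k, hk, hkd⟩ := hvert j hj
    exact mem_cthickening_of_dist_le _ k _ _ (hKimg hk) (by linarith)
  have hsegN : ∀ j ≤ n, ∀ z ∈ segment ℝ (meshPoint δ (f j)) (meshPoint δ (f (j + 1))),
      z ∈ cthickening 1 (Φ '' (Icc (-1 + s) (1 - s) ×ℂ Icc (-1 - s) (1 + s))) := by
    intro j hj z hz
    obtain ⟨k, hk, hkd⟩ := hvert j (by omega)
    have h1 : dist (meshPoint δ (f j)) z ≤ δ := dist_meshPoint_le_of_mem_segment hδ (hadjω j hj).1 hz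
    refine mem_cthickening_of_dist_le _ k _ _ (hKimg hk) ?_
    linarith [dist_triangle z (meshPoint δ (f j)) k, dist_comm z (meshPoint δ (f j))]
  have hKN : ∀ k ∈ range γ, k ∈ cthickening 1 (Φ '' (Icc (-1 + s) (1 - s) ×ℂ Icc (-1 - s) (1 + s))) :=
    fun k hk => self_subset_cthickening _ (hKimg hk)
  -- (M1) every site, read in the model, is `τ`-close to the closed tall quad
  have hM1 : ∀ j ≤ n + 1, (Φ.symm (meshPoint δ (f j))).re ∈ Ioo (-1 + s - τ) (1 - s + τ) ∧
      (Φ.symm (meshPoint δ (f j))).im ∈ Ioo (-1 - s - τ) (1 + s + τ) := by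
    intro j hj
    obtain ⟨k, hk, hkd⟩ := hvert j hj
    have hd : dist (Φ.symm (meshPoint δ (f j))) (Φ.symm k) < τ :=
      hmod _ (hvertN j hj) _ (hKN k hk) (by linarith)
    have hre := abs_re_sub_re_le_dist (Φ.symm (meshPoint δ (f j))) (Φ.symm k)
    have him := abs_im_sub_im_le_dist (Φ.symm (meshPoint δ (f j))) (Φ.symm k)
    obtain ⟨⟨hr1, hr2⟩, ⟨hi1, hi2⟩⟩ := hKrect k hk
    rw [abs_le] at hre him
    exact ⟨⟨by linarith, by linarith⟩, ⟨by linarith, by linarith⟩⟩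
  -- (M2) consecutive sites are `τ`-close in the model
  have hM2 : ∀ j ≤ n, dist (Φ.symm (meshPoint δ (f j))) (Φ.symm (meshPoint δ (f (j + 1)))) < τ := by
    intro j hj
    refine hmod _ (hvertN j (by omega)) _ (hvertN (j + 1) (by omega)) ?_
    rw [dist_meshPoint_of_adj (hadjω j hj).1, abs_of_pos hδ]
    exact hδη
  -- (M3) points of a drawn edge are `τ`-close to both its ends in the model
  have hM3 : ∀ j ≤ n, ∀ z ∈ segment ℝ (meshPoint δ (f j)) (meshPoint δ (f (j + 1))),
      dist (Φ.symm z) (Φ.symm (meshPoint δ (f j))) < τ ∧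
        dist (Φ.symm z) (Φ.symm (meshPoint δ (f (j + 1)))) < τ := by
    intro j hj z hz
    have hz' : z ∈ segment ℝ (meshPoint δ (f (j + 1))) (meshPoint δ (f j)) := by rwa [segment_symm]
    refine ⟨hmod _ (hsegN j hj z hz) _ (hvertN j (by omega)) ?_,
      hmod _ (hsegN j hj z hz) _ (hvertN (j + 1) (by omega)) ?_⟩
    · rw [dist_comm]
      exact (dist_meshPoint_le_of_mem_segment hδ (hadjω j hj).1 hz).trans_lt hδη
    · rw [dist_comm]
      exact (dist_meshPoint_le_of_mem_segment hδ (hadjω j hj).1.symm hz').trans_lt hδη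
  -- classification of the edges
  obtain ⟨good, hgood⟩ : ∃ good : ℕ → Prop, ∀ j, good j ↔
      (meshPoint δ (f j) ∈ R.carrier ∧ meshPoint δ (f (j + 1)) ∈ R.carrier ∧
        segment ℝ (meshPoint δ (f j)) (meshPoint δ (f (j + 1))) ⊆ closure R.carrier) :=
    ⟨_, fun _ => Iff.rfl⟩
  obtain ⟨low, hlow⟩ : ∃ low : ℕ → Prop, ∀ j, low j ↔
      ∃ z ∈ segment ℝ (meshPoint δ (f j)) (meshPoint δ (f (j + 1))), (Φ.symm z).im ≤ -1 :=
    ⟨_, fun _ => Iff.rfl⟩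
  obtain ⟨high, hhigh⟩ : ∃ high : ℕ → Prop, ∀ j, high j ↔
      ∃ z ∈ segment ℝ (meshPoint δ (f j)) (meshPoint δ (f (j + 1))), 1 ≤ (Φ.symm z).im :=
    ⟨_, fun _ => Iff.rfl⟩
  -- model abscissae of drawn edges stay in `[-1, 1]`
  have hband : ∀ j ≤ n, ∀ z ∈ segment ℝ (meshPoint δ (f j)) (meshPoint δ (f (j + 1))),
      (Φ.symm z).re ∈ Icc (-1 : ℝ) 1 := by
    intro j hj z hz
    have h1 := (hM3 j hj z hz).1
    have h2 := (hM1 j (by omega)).1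
    have h3 := abs_re_sub_re_le_dist (Φ.symm z) (Φ.symm (meshPoint δ (f j)))
    rw [abs_le] at h3
    exact ⟨by linarith [h2.1], by linarith [h2.2]⟩
  -- (E1) a non-good edge is low or high
  have hcases : ∀ j ≤ n, ¬ good j → low j ∨ high j := by
    intro j hj hng
    by_contra hcon
    rw [not_or, hlow, hhigh] at hcon
    push Not at hcon
    obtain ⟨hnl, hnh⟩ := hcon
    apply hng
    rw [hgood]
    have hzΩ : ∀ z ∈ segment ℝ (meshPoint δ (f j)) (meshPoint δ (f (j + 1))),
        (Φ.symm z).im ∈ Ioo (-1 : ℝ) 1 := fun z hz => ⟨hnl z hz, hnh z hz⟩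
    refine ⟨?_, ?_, fun z hz => ?_⟩
    · rw [SquareModelDict.mem_carrier_iff hΦ]
      have h := (hM1 j (by omega)).1
      exact ⟨⟨by linarith [h.1], by linarith [h.2]⟩, hzΩ _ (left_mem_segment ℝ _ _)⟩
    · rw [SquareModelDict.mem_carrier_iff hΦ]
      have h := (hM1 (j + 1) (by omega)).1
      exact ⟨⟨by linarith [h.1], by linarith [h.2]⟩, hzΩ _ (right_mem_segment ℝ _ _)⟩
    · rw [SquareModelDict.mem_closure_iff hΦ]
      exact ⟨hband j hj z hz, Ioo_subset_Icc_self (hzΩ z hz)⟩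
  -- (E2) no edge is both low and high
  have hexcl : ∀ j ≤ n, ¬ (low j ∧ high j) := by
    intro j hj
    rw [hlow, hhigh]
    rintro ⟨⟨z, hz, hzim⟩, ⟨z', hz', hz'im⟩⟩
    have h1 := (hM3 j hj z hz).1
    have h2 := (hM3 j hj z' hz').1
    have h3 := abs_im_sub_im_le_dist (Φ.symm z) (Φ.symm (meshPoint δ (f j)))
    have h4 := abs_im_sub_im_le_dist (Φ.symm z') (Φ.symm (meshPoint δ (f j)))
    rw [abs_le] at h3 h4
    linarith
  -- (E3) the first edge is low and not good, the last is high and not good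
  have h0 : ¬ good 0 ∧ low 0 := by
    refine ⟨fun hg => ?_, (hlow 0).2 ⟨a, haf, by rw [haim]; linarith⟩⟩
    rw [hgood] at hg
    have := ((SquareModelDict.mem_closure_iff hΦ).1 (hg.2.2 haf)).2.1
    rw [haim] at this; linarith
  have hn : ¬ good n ∧ high n := by
    refine ⟨fun hg => ?_, (hhigh n).2 ⟨b, hbf, by rw [hbim]; linarith⟩⟩
    rw [hgood] at hg
    have := ((SquareModelDict.mem_closure_iff hΦ).1 (hg.2.2 hbf)).2.2
    rw [hbim] at this; linarith
  -- (E4) a low edge is never followed by a high edge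
  have hadj : ∀ j < n, ¬ good j → low j → ¬ good (j + 1) → high (j + 1) → False := by
    intro j hj _ hl _ hh
    rw [hlow] at hl; rw [hhigh] at hh
    obtain ⟨z, hz, hzim⟩ := hl
    obtain ⟨z', hz', hz'im⟩ := hh
    have h1 := (hM3 j hj.le z hz).2
    have h2 := (hM3 (j + 1) (by omega) z' hz').1
    have h3 := abs_im_sub_im_le_dist (Φ.symm z) (Φ.symm (meshPoint δ (f (j + 1))))
    have h4 := abs_im_sub_im_le_dist (Φ.symm z') (Φ.symm (meshPoint δ (f (j + 1))))
    rw [abs_le] at h3 h4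
    linarith
  -- the crossing run
  obtain ⟨k₁, k₂, hk12, hk₂n, ⟨hng₁, hlow₁⟩, ⟨hng₂, hhigh₂⟩, hrun⟩ :=
    exists_good_run hcases hexcl h0 hn hadj
  have hrun' : ∀ m, k₁ < m → m < k₂ →
      meshPoint δ (f m) ∈ R.carrier ∧ meshPoint δ (f (m + 1)) ∈ R.carrier ∧
        segment ℝ (meshPoint δ (f m)) (meshPoint δ (f (m + 1))) ⊆ closure R.carrier :=
    fun m hm hm' => (hgood m).1 (hrun m hm hm')
  -- (V1) sites of the run are in `Ω`
  have hΩv : ∀ j, k₁ + 1 ≤ j → j ≤ k₂ → meshPoint δ (f j) ∈ R.carrier := by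
    intro j hj hj'
    rcases Nat.lt_or_ge j k₂ with h | h
    · exact (hrun' j (by omega) h).1
    · have hj2 : j = k₂ := le_antisymm hj' h
      have := (hrun' (k₂ - 1) (by omega) (by omega)).2.1
      rwa [show k₂ - 1 + 1 = k₂ by omega, ← hj2] at this
  -- heights of the two ends of the run
  rw [hlow] at hlow₁; rw [hhigh] at hhigh₂
  have him₁ : (Φ.symm (meshPoint δ (f (k₁ + 1)))).im < -1 + τ := by
    obtain ⟨z, hz, hzim⟩ := hlow₁
    have h1 := (hM3 k₁ (by omega) z hz).2
    have h3 := abs_im_sub_im_le_dist (Φ.symm z) (Φ.symm (meshPoint δ (f (k₁ + 1))))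
    rw [abs_le] at h3; linarith
  have him₁' : -1 < (Φ.symm (meshPoint δ (f (k₁ + 1)))).im :=
    ((SquareModelDict.mem_carrier_iff hΦ).1 (hΩv (k₁ + 1) le_rfl hk12.le)).2.1
  have him₂ : 1 - τ < (Φ.symm (meshPoint δ (f k₂))).im := by
    obtain ⟨z, hz, hzim⟩ := hhigh₂
    have h1 := (hM3 k₂ hk₂n z hz).1
    have h3 := abs_im_sub_im_le_dist (Φ.symm z) (Φ.symm (meshPoint δ (f k₂)))
    rw [abs_le] at h3; linarith
  have him₂' : (Φ.symm (meshPoint δ (f k₂))).im < 1 :=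
    ((SquareModelDict.mem_carrier_iff hΦ).1 (hΩv k₂ (by omega) le_rfl)).2.2
  -- (V5) the run meets the bulk compact, hence lies in the largest mesh component
  obtain ⟨l, hl₁, hl₂, hlim, hlim'⟩ := exists_first_ge (g := fun j => (Φ.symm (meshPoint δ (f j))).im)
    hk12 (c := -1 / 2) (t := τ) (by linarith) (by linarith) (by
      intro j hj hj'
      have h := hM2 j (by omega)
      have h3 := abs_im_sub_im_le_dist (Φ.symm (meshPoint δ (f (j + 1)))) (Φ.symm (meshPoint δ (f j)))
      rw [abs_le, dist_comm] at h3
      linarith)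
  have hlK : meshPoint δ (f l) ∈ Φ '' (Icc (-1 + s / 2) (1 - s / 2) ×ℂ Icc (-1 / 2 : ℝ) (1 / 2)) := by
    refine ⟨Φ.symm (meshPoint δ (f l)), Complex.mem_reProdIm.2 ⟨?_, ?_⟩, Φ.apply_symm_apply _⟩
    · have h := (hM1 l (by omega)).1
      exact ⟨by linarith [h.1], by linarith [h.2]⟩
    · exact ⟨hlim, by linarith⟩
  have hldom : f l ∈ meshDomain R.carrier δ := hbulk δ hδ hδ₂' (f l) hlK
  -- (V6) the whole run lies in the largest mesh component
  have hchain : ∀ j, k₁ + 1 ≤ j → j < k₂ →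
      (meshGraph R.carrier δ).Adj (f j) (f (j + 1)) ∧ f j ∈ meshVertices R.carrier δ ∧
        f (j + 1) ∈ meshVertices R.carrier δ := by
    intro j hj hj'
    obtain ⟨h1, h2, h3⟩ := hrun' j (by omega) hj'
    exact ⟨meshGraph_adj_iff.2 ⟨(hadjω j (by omega)).1, h3⟩, h1, h2⟩
  have hdom : ∀ j, k₁ + 1 ≤ j → j ≤ k₂ → f j ∈ meshDomain R.carrier δ :=
    forall_of_chain (r := fun x y => (meshGraph R.carrier δ).Adj x y ∧ x ∈ meshVertices R.carrier δ ∧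
        y ∈ meshVertices R.carrier δ) (P := fun x => x ∈ meshDomain R.carrier δ)
      (fun x y hxy hxd => mem_meshDomain_of_meshGraph_adj hxd hxy.2.2 hxy.1)
      (fun x y hxy hyd => mem_meshDomain_of_meshGraph_adj hyd hxy.2.1 hxy.1.symm)
      hchain hl₁.le hl₂ hldom
  -- (V7) the run is an open path of `Ω_δ`
  have hreach : (openGraph ω ⊓ discreteDomainGraph R.carrier δ).Reachable (f (k₁ + 1)) (f k₂) :=
    reachable_of_chain hk12.le fun j hj hj' =>
      open_inf_discreteDomainGraph_adj_iff.2 ⟨(hadjω j (by omega)).2, (hchain j hj hj').1,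
        hdom j hj (by omega), hdom (j + 1) (by omega) (by omega)⟩
  -- (V2)–(V4) the ends are discrete boundary vertices anchored at arc `0`, resp. arc `2`
  have hxb : f (k₁ + 1) ∈ meshBoundary R.carrier δ := by
    refine ⟨hdom (k₁ + 1) le_rfl hk12.le, f k₁, (hadjω k₁ (by omega)).1.symm, fun hA => hng₁ ?_⟩
    obtain ⟨hmg, -, hk₁dom⟩ := discreteDomainGraph_adj_iff.1 hA
    rw [hgood]
    refine ⟨meshDomain_subset_meshVertices _ _ hk₁dom, hΩv (k₁ + 1) le_rfl hk12.le, ?_⟩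
    rw [segment_symm]
    exact (meshGraph_adj_iff.1 hmg).2
  have hyb : f k₂ ∈ meshBoundary R.carrier δ := by
    refine ⟨hdom k₂ (by omega) le_rfl, f (k₂ + 1), (hadjω k₂ hk₂n).1, fun hA => hng₂ ?_⟩
    obtain ⟨hmg, -, hk₂dom⟩ := discreteDomainGraph_adj_iff.1 hA
    rw [hgood]
    exact ⟨hΩv k₂ (by omega) le_rfl, meshDomain_subset_meshVertices _ _ hk₂dom, (meshGraph_adj_iff.1 hmg).2⟩
  have hxarc : f (k₁ + 1) ∈ discreteArc R.carrier δ (R.arc 0) := by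
    refine mem_discreteArc_zero hΦ hsep₀ hδ hδρ₀ hxb (hadjω k₁ (by omega)).1.symm ?_ ⟨him₁', by linarith⟩ ?_ ?_
    · have h := (hM1 (k₁ + 1) (by omega)).1
      exact ⟨by linarith [h.1], by linarith [h.2]⟩
    · obtain ⟨z, hz, hzim⟩ := hlow₁
      exact ⟨z, by rwa [segment_symm], hzim⟩
    · intro z hz
      rw [segment_symm] at hz
      exact hband k₁ (by omega) z hz
  have hyarc : f k₂ ∈ discreteArc R.carrier δ (R.arc 2) := by
    refine mem_discreteArc_two hΦ hsep₂ hδ hδρ₂ hyb (hadjω k₂ hk₂n).1 ?_ ⟨by linarith, him₂'⟩ hhigh₂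
      (hband k₂ hk₂n)
    have h := (hM1 k₂ (by omega)).1
    exact ⟨by linarith [h.1], by linarith [h.2]⟩
  exact ⟨f (k₁ + 1), hxarc, f k₂, hyarc, hreach⟩


end Summit.CriticalPhenomena.CardyFormulaZ2.Theorems.ClusterSetConnected

end
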